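import Literature.Analysis.FluidPDE.NSLerayHopfSereginEnergyProofs
import Literature.Analysis.FluidPDE.KatoMaximalTime
import Literature.Analysis.FluidPDE.KatoFarFieldBound
import Literature.Analysis.FluidPDE.KatoL3Uniqueness
import Literature.Analysis.FluidPDE.RusinSverakLeraySolutions
import Literature.Analysis.FluidPDE.VectorCalculus
import HarnessLib

/-!
# Locally bounded global Leray–Hopf solutions from Clay data are Clay solutions (datum-wise bridge)

Analysis/FluidPDE proof file (theorems only). The tree has the GLOBAL-hypothesis bridges «a-priori sup bound
for every classical Leray–Hopf solution ⇒ Fefferman (A)»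
(`Summit.NavierStokesRegularity.StrongHypotheses.navierStokesRegularity_of_classicalSupBound`) and «no
blow-up ⇒ (A)» (`typeICertificateLadder_noBlowupToClay_proof`). Claimed proofs adjudicated by the cell
`ns-claims` (D-0090) frequently need the DATUM-WISE form: ONE global Leray–Hopf solution from ONE Clay datum
which is (essentially) bounded near every point gives a Clay-sense solution for THAT datum (the Serrin class
`L^∞_t L^∞_x`, Serrin 1962; Lemarié-Rieusset 2016 Prop. 12.3 / Thm. 15.1). This file proves it over the
tree's engines, in the pattern of the no-blow-up frame:

* `IsGlobalLerayHopf.ae_eq_of_isKatoSolutionOn_of_decay` / `…_uncurry_…` — for a smooth divergence-free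
  RAPIDLY DECAYING datum (the tree's `IsGlobalLerayHopf.ae_eq_of_isKatoSolutionOn` asks compact support),
  a global Leray–Hopf solution agrees a.e. with every Kato solution on its window (weak–strong uniqueness
  through the bounded Tao-class solutions, `weak_strong_uniqueness_holds` + `IsTaoSolutionOn.ae_eq_of_kato`);
* `clay_solution_of_locallyBounded_globalLerayHopf` — if moreover `u` is essentially bounded on some
  parabolic cylinder below every point `(T, x)`, `T > 0`, then the Clay problem for the datum is solvable:
  Kato maximal-time dichotomy (`clay_solution_of_hasGlobalKatoSolution_holds` /
  `lemarieRieusset_singular_point_of_blowup_holds` + `eLpNorm_parabolicCylinder_eq_top_of_ae_eq`);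
* `clay_solution_of_bounded_globalLerayHopf` — the special case of a pointwise bound on `[0,∞) × ℝ³`.

WHAT THIS IS NOT: not a claim about NS regularity or blow-up; not a claim about any author beyond the
typed locator.

## References
* J. Serrin, Arch. Rational Mech. Anal. 9 (1962) 187–195 (the `L^q_tL^r_x` class). [Serrin1962]
* P. G. Lemarié-Rieusset, *The Navier–Stokes Problem in the 21st Century*, CRC 2016, Prop. 12.3, Thm. 15.1 (C). [LemarieRieusset2016]
-/

noncomputable section

open MeasureTheory Set Function Filter Topology Metric
open scoped ENNReal NNReal ContDiff

namespace Literature.Analysis.FluidPDE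

variable {ν : ℝ} {a : EuclideanSpace ℝ (Fin 3) → EuclideanSpace ℝ (Fin 3)}
  {v : ℝ → EuclideanSpace ℝ (Fin 3) → EuclideanSpace ℝ (Fin 3)}

/-- **Global Leray–Hopf vs Kato, rapidly decaying datum**: for `ν > 0`, a smooth divergence-free rapidly
decaying datum `a`, a global Leray–Hopf solution `v` from `a` and a Kato solution `w` from `a` on `[0,T')`,
`v(t) = w(t)` a.e. for `0 < t < T'` (Prodi–Serrin weak–strong uniqueness through the bounded Tao-class
solution on `[0,S]`, `t < S < T'`, and uniqueness in `C([0,S);L³)`).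
[cite: LemarieRieusset2016, Prop. 12.3 with Thm. 7.7] -/
theorem IsGlobalLerayHopf.ae_eq_of_isKatoSolutionOn_of_decay (hν : 0 < ν) (ha : ContDiff ℝ ∞ a)
    (hdiv : VectorCalculus.IsDivFree a) (hdec : HasRapidSpatialDecay a) (hv : IsGlobalLerayHopf ν 0 a v)
    {T' : ℝ} {w : ℝ → EuclideanSpace ℝ (Fin 3) → EuclideanSpace ℝ (Fin 3)}
    (hw : IsKatoSolutionOn T' ν a w) : ∀ t ∈ Ioo 0 T', v t =ᵐ[volume] w t := by
  intro t ht
  set S : ℝ := (t + T') / 2 with hS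
  have htS : t < S := by rw [hS]; linarith [ht.2]
  have hST' : S < T' := by rw [hS]; linarith [ht.2]
  have hS0 : 0 < S := ht.1.trans htS
  have hdiv' : NSWave0.IsDivFree a := hdiv
  obtain ⟨u, p, hu⟩ := exists_isTaoSolutionOn_of_isKatoSolutionOn hν ha hdiv' hdec hw hS0 hST'
  have hLH : IsLerayHopfOn S ν 0 a u := hu.isLerayHopfOn hS0
  obtain ⟨B, -, hB⟩ := hu.exists_bound_velocity
  have hSer : MemLqLp ∞ ∞ u (Ioo 0 S) :=
    memLqLp_top_top_of_bound (fun s hs => hu.aestronglyMeasurable_slice hs) hB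
  have h1 : v t =ᵐ[volume] u t :=
    weak_strong_uniqueness_holds hν hS0 hLH (q := ∞) (r := ∞) ENNReal.ofNat_lt_top
      (by simp [ENNReal.div_top]) hSer (hv.isLerayHopfOn hS0) t ⟨ht.1, htS.le⟩
  have h2 : u t =ᵐ[volume] w t :=
    hu.ae_eq_of_kato hν (hw.mild.mono (Ico_subset_Ico_right hST'.le))
      (hw.continuousInLpOn.mono (Ico_subset_Ico_right hST'.le))
      (hw.aestronglyMeasurable.mono_measure (Measure.restrict_mono
        (Set.prod_mono (Ioo_subset_Ioo_right hST'.le) Subset.rfl) le_rfl)) t ⟨ht.1.le, htS⟩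
  exact h1.trans h2

/-- Space–time form of `IsGlobalLerayHopf.ae_eq_of_isKatoSolutionOn_of_decay`: `v = w` a.e. on the strip
`(0,T') × ℝ³`. [cite: LemarieRieusset2016, Prop. 12.3 with Thm. 7.7] -/
theorem IsGlobalLerayHopf.ae_eq_uncurry_of_isKatoSolutionOn_of_decay (hν : 0 < ν) (ha : ContDiff ℝ ∞ a)
    (hdiv : VectorCalculus.IsDivFree a) (hdec : HasRapidSpatialDecay a) (hv : IsGlobalLerayHopf ν 0 a v)
    {T' : ℝ} (hT' : 0 < T') {w : ℝ → EuclideanSpace ℝ (Fin 3) → EuclideanSpace ℝ (Fin 3)}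
    (hw : IsKatoSolutionOn T' ν a w) :
    uncurry v =ᵐ[volume.restrict (Ioo 0 T' ×ˢ univ)] uncurry w :=
  ae_restrict_prod_of_forall_ae_eq (hv.ae_eq_of_isKatoSolutionOn_of_decay hν ha hdiv hdec hw)
    (hv.isLerayHopfOn hT').weak.1 hw.aestronglyMeasurable

/-- **Locally bounded global Leray–Hopf solutions from Clay data are Clay solutions.** For `ν > 0` and a
Clay datum `a` (smooth, divergence free, rapidly decaying), if some global Leray–Hopf solution `v` from `a`
is essentially bounded on a parabolic cylinder `Q_r(T, x)` below every point `(T, x)` with `T > 0`, then the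
Cauchy problem for `a` has a solution in Fefferman's class (smooth on `ℝ³ × [0,∞)`, bounded energy).
Kato maximal-time dichotomy: a finite maximal time would carry a singular point of the maximal Kato
solution, which agrees with `v` a.e. [cite: LemarieRieusset2016, Thm. 15.1 (C) and Prop. 12.3] [cite: Serrin1962, Thm. (L^∞ case)] -/
theorem clay_solution_of_locallyBounded_globalLerayHopf (hν : 0 < ν) (ha : ContDiff ℝ ∞ a)
    (hdiv : NSWave0.IsDivFree a) (hdec : HasRapidSpatialDecay a) (hv : IsGlobalLerayHopf ν 0 a v)
    (hbd : ∀ T : ℝ, 0 < T → ∀ x : EuclideanSpace ℝ (Fin 3), ∃ r : ℝ, 0 < r ∧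
      eLpNorm (uncurry v) ⊤ (volume.restrict (parabolicCylinder r ((T : ℝ), x))) < ⊤) :
    ∃ (U : ℝ → EuclideanSpace ℝ (Fin 3) → EuclideanSpace ℝ (Fin 3)) (P : ℝ → EuclideanSpace ℝ (Fin 3) → ℝ),
      IsSmoothOnHalfSpace U ∧ IsSmoothOnHalfSpace P ∧ IsNavierStokesSolution ν 0 a U P ∧
        HasBoundedEnergy U := by
  classical
  have hdiv' : VectorCalculus.IsDivFree a := fun x => hdiv x
  -- the datum: `L²`, `L³`, weakly divergence free
  have hHk : ∀ n : ℕ, ∫⁻ x, ‖iteratedFDeriv ℝ n a x‖ₑ ^ 2 < ⊤ :=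
    hdec.lintegral_enorm_iteratedFDeriv_sq_lt_top
  have hmeas0 : AEStronglyMeasurable a volume := ha.continuous.aestronglyMeasurable
  have hL2 : ∫⁻ x, ‖a x‖ₑ ^ 2 < ⊤ := by
    refine lt_of_le_of_lt (le_of_eq (lintegral_congr fun x => ?_)) (hHk 0)
    rw [← ofReal_norm, ← ofReal_norm, norm_iteratedFDeriv_zero]
  have hu2 : MemLp a 2 volume := ⟨hmeas0, eLpNorm_two_lt_top_of_lintegral_enorm_sq_lt_top hL2⟩
  obtain ⟨C₀, hC₀⟩ := hdec 0 0
  have hbd0 : ∀ x, ‖a x‖ ≤ C₀ := fun x => by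
    have h := hC₀ x
    rwa [pow_zero, one_mul, norm_iteratedFDeriv_zero] at h
  have hu3 : MemLp a 3 volume := by
    refine ⟨hmeas0, ?_⟩
    have h3 : eLpNorm a 3 volume ^ 3 ≤ eLpNorm a ⊤ volume * eLpNorm a 2 volume ^ 2 :=
      eLpNorm_three_pow_le hmeas0
    have htop : eLpNorm a ⊤ volume ≤ ENNReal.ofReal C₀ := eLpNorm_top_le_of_bound hbd0
    have hfin : eLpNorm a ⊤ volume * eLpNorm a 2 volume ^ 2 < ⊤ :=
      ENNReal.mul_lt_top (htop.trans_lt ENNReal.ofReal_lt_top) (ENNReal.pow_lt_top hu2.eLpNorm_lt_top)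
    by_contra hnot
    rw [not_lt, top_le_iff] at hnot
    rw [hnot, ENNReal.top_pow (by norm_num)] at h3
    exact absurd (h3.trans_lt hfin) (lt_irrefl _)
  have hwdiv : IsWeaklyDivFree a :=
    VectorCalculus.IsDivFree.isWeaklyDivFree_holds hdiv' (ha.of_le (mod_cast le_top))
  -- the Kato maximal time
  by_cases htop : katoMaximalTime ν a = ⊤
  · exact clay_solution_of_hasGlobalKatoSolution_holds ν hν a ha hdiv hdec
      (hasGlobalKatoSolution_of_katoMaximalTime_eq_top kato_unique_holds hν htop)
  exfalso
  have hTm0 : 0 < katoMaximalTime ν a := katoMaximalTime_pos kato_local_holds hν hu3 hwdiv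
  have htop' : katoMaximalTime ν a < ⊤ := lt_top_iff_ne_top.2 htop
  obtain ⟨w, hw⟩ := exists_isKatoSolutionOn_katoMaximalTime kato_unique_holds hν hTm0 htop'
  set T : ℝ := (katoMaximalTime ν a).toReal with hT_def
  have hT0 : 0 < T := ENNReal.toReal_pos hTm0.ne' htop'.ne
  have hofReal : ENNReal.ofReal T = katoMaximalTime ν a := ENNReal.ofReal_toReal htop'.ne
  have hmax : ∀ T'' : ℝ, T < T'' → ∀ w' : ℝ → EuclideanSpace ℝ (Fin 3) → EuclideanSpace ℝ (Fin 3),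
      ¬ IsKatoSolutionOn T'' ν a w' :=
    fun T'' hT'' w' => not_isKatoSolutionOn_of_katoMaximalTime_lt (by
      rw [← hofReal]
      exact (ENNReal.ofReal_lt_ofReal_iff (hT0.trans hT'')).2 hT'')
  obtain ⟨x₁, hx₁⟩ := lemarieRieusset_singular_point_of_blowup_holds hν hT0 hu3 hwdiv hw hmax
  have hall : ∀ r : ℝ, 0 < r →
      eLpNorm (uncurry w) ⊤ (volume.restrict (parabolicCylinder r ((T : ℝ), x₁))) = ⊤ :=
    fun r hr => eLpNorm_top_parabolicCylinder_eq_top_of_small hT0 hx₁ hr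
  have hae : uncurry v =ᵐ[volume.restrict (Ioo 0 T ×ˢ (univ : Set (EuclideanSpace ℝ (Fin 3))))]
      uncurry w :=
    hv.ae_eq_uncurry_of_isKatoSolutionOn_of_decay hν ha hdiv' hdec hT0 hw
  obtain ⟨r, hr0, hbdv⟩ := hbd T hT0 x₁
  exact hbdv.ne (eLpNorm_parabolicCylinder_eq_top_of_ae_eq hT0 hae x₁ hall hr0)

/-- **Bounded global Leray–Hopf solutions from Clay data are Clay solutions** (the `L^∞_tL^∞_x` Serrin
class, datum-wise): `ν > 0`, `a` a Clay datum, `v` a global Leray–Hopf solution from `a` with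
`‖v(t,x)‖ ≤ M` for `t ≥ 0`; then the Cauchy problem for `a` is solvable in Fefferman's class.
[cite: Serrin1962, Thm. (L^∞ case)] [cite: LemarieRieusset2016, Thm. 15.1 (C) and Prop. 12.3] -/
theorem clay_solution_of_bounded_globalLerayHopf (hν : 0 < ν) (ha : ContDiff ℝ ∞ a)
    (hdiv : NSWave0.IsDivFree a) (hdec : HasRapidSpatialDecay a) (hv : IsGlobalLerayHopf ν 0 a v)
    (hbd : ∃ M : ℝ, ∀ t : ℝ, 0 ≤ t → ∀ x, ‖v t x‖ ≤ M) :
    ∃ (U : ℝ → EuclideanSpace ℝ (Fin 3) → EuclideanSpace ℝ (Fin 3)) (P : ℝ → EuclideanSpace ℝ (Fin 3) → ℝ),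
      IsSmoothOnHalfSpace U ∧ IsSmoothOnHalfSpace P ∧ IsNavierStokesSolution ν 0 a U P ∧
        HasBoundedEnergy U := by
  obtain ⟨M, hM⟩ := hbd
  refine clay_solution_of_locallyBounded_globalLerayHopf hν ha hdiv hdec hv fun T hT x => ?_
  -- the cylinder `Q_r(T, x)` with `r² ≤ T/2` lies in `t ≥ 0`
  set r : ℝ := min 1 (Real.sqrt (T / 2)) with hr_def
  have hr0 : 0 < r := lt_min one_pos (Real.sqrt_pos.2 (by positivity))
  have hr2 : r ^ 2 ≤ T / 2 := by
    calc r ^ 2 ≤ Real.sqrt (T / 2) ^ 2 := pow_le_pow_left₀ hr0.le (min_le_right _ _) 2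
      _ = T / 2 := Real.sq_sqrt (by positivity)
  refine ⟨r, hr0, ?_⟩
  rw [eLpNorm_exponent_top]
  refine eLpNormEssSup_lt_top_of_ae_bound (C := M) ?_
  filter_upwards [ae_restrict_mem (isOpen_parabolicCylinder r ((T : ℝ), x)).measurableSet] with z hz
  obtain ⟨s, y⟩ := z
  rw [mem_parabolicCylinder] at hz
  exact hM s (by linarith [hz.1.1, hr2]) y

end Literature.Analysis.FluidPDE
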